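import Mathlib
import Summits.PneNP.PneNP.Theorems.ConvexRankGatesCaptureSignedDefs

/-!
# Route ConvexRankGates, crux `Capture` (stmt-PneNP-2659): the matching gadget is SOUND — a perfect matching forces
an unbalanced selection (unbalanced-cycle door, file 3/5)

Support theorems for the crux `Summit.PneNP.PneNP.Theses.ConvexRankGates.Capture` (lead c10); objects from
`ConvexRankGatesCaptureSignedDefs.lean`. The gadget `gadget p q o v` has, for every replica `w : V`, an `in` and an
`out` copy of every node of the signed double cover, joined by a skip edge; inside each replica a selected wire `i`
switches on the arcs `out(z) — in(z')` over its cover edges `z — z'`; a source absorber `g` is joined to every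
`in_w(w,0)` and a sink absorber `g'` to every `out_w(w,1)`.

* `adj_src_iff`, `adj_snk_iff`, `adj_in_cases`, `adj_out_cases` — neighbourhoods in the gadget.
* `even_card_of_closed` — in a perfect matching a vertex set closed under partners is even (partner map is a
  fixed-point-free involution).
* `unbalanced_of_isPerfectMatching` (registered anchor) — SOUNDNESS: a perfect matching of the gadget forces
  `Unbalanced p q o v`. The source absorber is matched into some replica `w`; were `(w,0) ≁ (w,1)` in the cover, the
  `in/out` copies over the cover component of `(w,0)` inside replica `w`, minus `in_w(w,0)` (taken by `g`), would be an
  ODD set closed under partners — the two-absorber parity trick that makes the OR over replicas a single matching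
  instance.

Completeness (`exists_isPerfectMatching_of_unbalanced`) is file 4/5, the GRANK gate file 5/5. No new definitions.
[folklore]
-/

namespace Summit.PneNP.PneNP.Theorems.Capture.Signed

set_option linter.dupNamespace false -- `Summit.PneNP.PneNP.…`: summit = sub-problem (D-0017)

open SimpleGraph Finset

variable {V : Type} {n : ℕ} {p q : Fin n → V} {o : Fin n → Bool}

/-- A lift of a wire joins its two cover nodes. [folklore] -/
theorem reachable_of_drel {v : Fin n → Bool} {i : Fin n} (hi : v i = true) {z z' : V × Bool}
    (h : Drel p q o i z z') : (cover p q o v).Reachable z z' := by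
  by_cases hzz : z = z'
  · rw [hzz]
  · exact Adj.reachable (cover_adj_iff_drel.2 ⟨hzz, i, hi, h⟩)


/-! ### Neighbourhoods in the gadget -/

/-- Neighbours of the source absorber `g`: exactly the vertices `in_w(w,0)`. [folklore] -/
theorem adj_src_iff {v : Fin n → Bool} {y : GV V} :
    (gadget p q o v).Adj (Sum.inr false) y ↔ ∃ w : V, y = Sum.inl (w, (w, false), false) := by
  rw [gadget_adj]
  constructor
  · rintro ⟨-, (h | ⟨i, -, h⟩) | (h | ⟨i, -, h⟩)⟩
    · rcases h with ⟨w', z', hx, -⟩ | ⟨w', -, hy⟩ | ⟨w', hx, -⟩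
      · simp at hx
      · exact ⟨w', hy⟩
      · simp at hx
    · obtain ⟨w', z', z'', hx, -, -⟩ := h
      simp at hx
    · rcases h with ⟨w', z', -, hx⟩ | ⟨w', -, hx⟩ | ⟨w', -, hx⟩
      · simp at hx
      · simp at hx
      · simp at hx
    · obtain ⟨w', z', z'', -, hx, -⟩ := h
      simp at hx
  · rintro ⟨w, rfl⟩
    exact ⟨by simp, Or.inl (Or.inl (Or.inr (Or.inl ⟨w, rfl, rfl⟩)))⟩

/-- Neighbours of the sink absorber `g'`: exactly the vertices `out_w(w,1)`. [folklore] -/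
theorem adj_snk_iff {v : Fin n → Bool} {y : GV V} :
    (gadget p q o v).Adj (Sum.inr true) y ↔ ∃ w : V, y = Sum.inl (w, (w, true), true) := by
  rw [gadget_adj]
  constructor
  · rintro ⟨-, (h | ⟨i, -, h⟩) | (h | ⟨i, -, h⟩)⟩
    · rcases h with ⟨w', z', hx, -⟩ | ⟨w', hx, -⟩ | ⟨w', hx, -⟩
      · simp at hx
      · simp at hx
      · simp at hx
    · obtain ⟨w', z', z'', hx, -, -⟩ := h
      simp at hx
    · rcases h with ⟨w', z', -, hx⟩ | ⟨w', -, hx⟩ | ⟨w', hy, hx⟩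
      · simp at hx
      · simp at hx
      · exact ⟨w', hy⟩
    · obtain ⟨w', z', z'', -, hx, -⟩ := h
      simp at hx
  · rintro ⟨w, rfl⟩
    exact ⟨by simp, Or.inr (Or.inl (Or.inr (Or.inr ⟨w, rfl, rfl⟩)))⟩

/-- Neighbours of an `in`-vertex: `out`-vertices of the same replica over the same or an adjacent cover node,
or the source absorber (only for `in_w(w,0)`). [folklore] -/
theorem adj_in_cases {v : Fin n → Bool} {w : V} {z : V × Bool} {y : GV V}
    (h : (gadget p q o v).Adj (Sum.inl (w, z, false)) y) :
    (∃ z', y = Sum.inl (w, z', true) ∧ (cover p q o v).Reachable z z') ∨ (y = Sum.inr false ∧ z = (w, false)) := by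
  rw [gadget_adj] at h
  obtain ⟨-, (h | ⟨i, hi, h⟩) | (h | ⟨i, hi, h⟩)⟩ := h
  · rcases h with ⟨w', z', hx, hy⟩ | ⟨w', hx, -⟩ | ⟨w', hx, -⟩
    · simp only [Sum.inl.injEq, Prod.mk.injEq, and_true] at hx
      obtain ⟨rfl, rfl⟩ := hx
      exact Or.inl ⟨z, hy, Reachable.refl _⟩
    · simp at hx
    · simp at hx
  · obtain ⟨w', z', z'', hx, -, -⟩ := h
    simp at hx
  · rcases h with ⟨w', z', -, hx⟩ | ⟨w', hy, hx⟩ | ⟨w', -, hx⟩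
    · simp at hx
    · simp only [Sum.inl.injEq, Prod.mk.injEq, and_true] at hx
      obtain ⟨rfl, rfl⟩ := hx
      exact Or.inr ⟨hy, rfl⟩
    · simp at hx
  · obtain ⟨w', z', z'', hy, hx, hd⟩ := h
    simp only [Sum.inl.injEq, Prod.mk.injEq, and_true] at hx
    obtain ⟨rfl, rfl⟩ := hx
    exact Or.inl ⟨z', hy, (reachable_of_drel hi hd).symm⟩

/-- Neighbours of an `out`-vertex: `in`-vertices of the same replica over the same or an adjacent cover node,
or the sink absorber (only for `out_w(w,1)`). [folklore] -/
theorem adj_out_cases {v : Fin n → Bool} {w : V} {z : V × Bool} {y : GV V}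
    (h : (gadget p q o v).Adj (Sum.inl (w, z, true)) y) :
    (∃ z', y = Sum.inl (w, z', false) ∧ (cover p q o v).Reachable z z') ∨ (y = Sum.inr true ∧ z = (w, true)) := by
  rw [gadget_adj] at h
  obtain ⟨-, (h | ⟨i, hi, h⟩) | (h | ⟨i, hi, h⟩)⟩ := h
  · rcases h with ⟨w', z', hx, -⟩ | ⟨w', hx, -⟩ | ⟨w', hx, hy⟩
    · simp at hx
    · simp at hx
    · simp only [Sum.inl.injEq, Prod.mk.injEq, and_true] at hx
      obtain ⟨rfl, rfl⟩ := hx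
      exact Or.inr ⟨hy, rfl⟩
  · obtain ⟨w', z', z'', hx, hy, hd⟩ := h
    simp only [Sum.inl.injEq, Prod.mk.injEq, and_true] at hx
    obtain ⟨rfl, rfl⟩ := hx
    exact Or.inl ⟨z'', hy, reachable_of_drel hi hd⟩
  · rcases h with ⟨w', z', hy, hx⟩ | ⟨w', -, hx⟩ | ⟨w', -, hx⟩
    · simp only [Sum.inl.injEq, Prod.mk.injEq, and_true] at hx
      obtain ⟨rfl, rfl⟩ := hx
      exact Or.inl ⟨z, hy, Reachable.refl _⟩
    · simp at hx
    · simp at hx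
  · obtain ⟨w', z', z'', -, hx, -⟩ := h
    simp at hx


/-! ### A perfect matching forces an unbalanced selection -/

/-- In a perfect matching, a finite vertex set closed under partners has even size (the partner map is a
fixed-point-free involution). [folklore] -/
theorem even_card_of_closed {W : Type} [DecidableEq W] {G : SimpleGraph W} {M : G.Subgraph}
    (hM : M.IsPerfectMatching) (X : Finset W) (hX : ∀ x ∈ X, ∀ y, M.Adj x y → y ∈ X) : Even X.card := by
  -- the partner map
  have hex : ∀ x, ∃ y, M.Adj x y := fun x => (Subgraph.isPerfectMatching_iff.1 hM x).exists
  choose f hf using hex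
  have huniq : ∀ x y, M.Adj x y → y = f x := fun x y hxy =>
    (Subgraph.isPerfectMatching_iff.1 hM x).unique hxy (hf x)
  have hff : ∀ x, f (f x) = x := fun x => (huniq (f x) x (hf x).symm).symm
  have hfne : ∀ x, f x ≠ x := fun x hfx => (M.adj_sub (hf x)).ne hfx.symm
  suffices hmain : ∀ (N : ℕ) (X : Finset W), X.card ≤ N → (∀ x ∈ X, ∀ y, M.Adj x y → y ∈ X) → Even X.card from
    hmain _ X le_rfl hX
  intro N
  induction N with
  | zero =>
    intro X hX _
    rw [Nat.le_zero.1 hX]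
    exact Even.zero
  | succ N ih =>
    intro X hXN hX
    rcases Finset.eq_empty_or_nonempty X with rfl | ⟨x, hx⟩
    · simp
    · have hfx : f x ∈ X := hX x hx _ (hf x)
      set X' := (X.erase x).erase (f x) with hX'
      have hcard : X'.card + 2 = X.card := by
        have h1 : (X.erase x).card + 1 = X.card := Finset.card_erase_add_one hx
        have h2 : X'.card + 1 = (X.erase x).card :=
          Finset.card_erase_add_one (Finset.mem_erase.2 ⟨hfne x, hfx⟩)
        omega
      have hclosed : ∀ x' ∈ X', ∀ y, M.Adj x' y → y ∈ X' := by
        intro x' hx' y hy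
        simp only [hX', Finset.mem_erase] at hx' ⊢
        obtain ⟨hx'f, hx'x, hx'X⟩ := hx'
        refine ⟨?_, ?_, hX x' hx'X y hy⟩
        · rintro rfl
          exact hx'x ((huniq _ _ hy.symm).trans (hff x))
        · rintro rfl
          exact hx'f (huniq _ _ hy.symm)
      have heven := ih X' (by omega) hclosed
      rw [← hcard]
      exact heven.add (by decide)

/-- **Soundness of the gadget**: a perfect matching of `gadget p q o v` forces `Unbalanced p q o v`. The source
absorber `g` is matched into some replica `w`; if `(w,0) ≁ (w,1)` in the cover, the `in/out` copies over the cover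
component of `(w,0)` inside replica `w`, minus `in_w(w,0)` (taken by `g`), form an ODD set closed under partners.
[folklore] -/
theorem unbalanced_of_isPerfectMatching : ∀ {V : Type} [Fintype V] [DecidableEq V] {n : ℕ} {p q : Fin n → V}
    {o : Fin n → Bool} {v : Fin n → Bool} {M : (gadget p q o v).Subgraph},
    M.IsPerfectMatching → Unbalanced p q o v := by
  intro V _ _ n p q o v M hM
  classical
  have hM' := Subgraph.isPerfectMatching_iff.1 hM
  -- the source absorber is matched into replica `w`
  obtain ⟨y₀, hy₀, -⟩ := hM' (Sum.inr false)
  obtain ⟨w, rfl⟩ := adj_src_iff.1 (M.adj_sub hy₀)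
  by_contra hbal
  have hww : ¬ (cover p q o v).Reachable (w, false) (w, true) := fun h => hbal ⟨w, h⟩
  -- the cover component of `(w,0)` and the gadget vertices over it
  let C : Finset (V × Bool) := Finset.univ.filter fun z => (cover p q o v).Reachable (w, false) z
  have hC : ∀ z, z ∈ C ↔ (cover p q o v).Reachable (w, false) z := fun z => by simp [C]
  let emb : (V × Bool) × Bool → GV V := fun zb => Sum.inl (w, zb.1, zb.2)
  have hemb : Function.Injective emb := by
    rintro ⟨z1, b1⟩ ⟨z2, b2⟩ h
    simp only [emb, Sum.inl.injEq, Prod.mk.injEq, true_and] at h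
    rw [h.1, h.2]
  let X : Finset (GV V) :=
    ((C ×ˢ (Finset.univ : Finset Bool)).image emb).erase (Sum.inl (w, (w, false), false))
  have hXform : ∀ x ∈ X, ∃ z b, x = Sum.inl (w, z, b) := by
    intro x hx
    rw [Finset.mem_erase, Finset.mem_image] at hx
    obtain ⟨-, ⟨z, b⟩, -, rfl⟩ := hx
    exact ⟨z, b, rfl⟩
  have hXmem : ∀ z b, Sum.inl (w, z, b) ∈ X ↔
      (cover p q o v).Reachable (w, false) z ∧ ¬ (z = (w, false) ∧ b = false) := by
    intro z b
    rw [Finset.mem_erase, Finset.mem_image]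
    constructor
    · rintro ⟨hne, ⟨z', b'⟩, hzb, hzbeq⟩
      rw [Finset.mem_product, hC] at hzb
      simp only [emb, Sum.inl.injEq, Prod.mk.injEq, true_and] at hzbeq
      obtain ⟨rfl, rfl⟩ := hzbeq
      refine ⟨hzb.1, fun h => hne ?_⟩
      rw [h.1, h.2]
    · rintro ⟨hz, hne⟩
      refine ⟨fun h => hne ?_, ⟨z, b⟩, ?_, rfl⟩
      · simpa only [Sum.inl.injEq, Prod.mk.injEq, true_and] using h
      · rw [Finset.mem_product, hC]
        exact ⟨hz, Finset.mem_univ _⟩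
  -- `in_w(w,0)` is matched to `g` only
  have hin0 : ∀ x, M.Adj x (Sum.inl (w, (w, false), false)) → x = Sum.inr false := by
    intro x hx
    obtain ⟨u, -, hu⟩ := hM' (Sum.inl (w, (w, false), false))
    exact (hu x hx.symm).trans (hu _ hy₀.symm).symm
  have hclosed : ∀ x ∈ X, ∀ y, M.Adj x y → y ∈ X := by
    intro x hx y hxy
    obtain ⟨z, b, rfl⟩ := hXform x hx
    obtain ⟨hz, hne⟩ := (hXmem z b).1 hx
    cases b
    · -- in-vertex, `z ≠ (w,0)`
      have hz0 : z ≠ (w, false) := fun h => hne ⟨h, rfl⟩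
      rcases adj_in_cases (M.adj_sub hxy) with ⟨z', rfl, hzz'⟩ | ⟨rfl, hz'⟩
      · exact (hXmem z' true).2 ⟨hz.trans hzz', fun h => Bool.noConfusion h.2⟩
      · exact (hz0 hz').elim
    · -- out-vertex
      rcases adj_out_cases (M.adj_sub hxy) with ⟨z', rfl, hzz'⟩ | ⟨rfl, hz'⟩
      · refine (hXmem z' false).2 ⟨hz.trans hzz', fun h => ?_⟩
        obtain ⟨rfl, -⟩ := h
        exact absurd (hin0 _ hxy) (by simp)
      · rw [hz'] at hz
        exact (hww hz).elim
  have heven := even_card_of_closed hM X hclosed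
  -- but `X` is odd: `2 |C| - 1` with `(w,0) ∈ C`
  have hwC : (w, false) ∈ C := (hC _).2 (Reachable.refl _)
  have hcardX : X.card + 1 = C.card * 2 := by
    have h1 : ((C ×ˢ (Finset.univ : Finset Bool)).image emb).card = C.card * 2 := by
      rw [Finset.card_image_of_injective _ hemb, Finset.card_product]
      simp
    have hmem : Sum.inl (w, (w, false), false) ∈ (C ×ˢ (Finset.univ : Finset Bool)).image emb :=
      Finset.mem_image.2 ⟨((w, false), false), Finset.mem_product.2 ⟨hwC, Finset.mem_univ _⟩, rfl⟩
    have h2 := Finset.card_erase_add_one hmem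
    rw [h1] at h2
    exact h2
  have hCpos : 0 < C.card := Finset.card_pos.2 ⟨_, hwC⟩
  obtain ⟨r, hr⟩ := heven
  omega


end Summit.PneNP.PneNP.Theorems.Capture.Signed
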